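import Literature.Computability.MetaComplexity.BoundedArithUnivTheory
import HarnessLib

/-!
# Skolem terms in Herbrand-saturated models of the universal theory

Topic `Literature/Computability/MetaComplexity` (continuation of `BoundedArithUnivTheory.lean`).
In a model `K` of `QSym.univTheory k` we construct:

* `QSym.charTerm φ` — a **characteristic term** for every formula `φ` of `Language.qsym k`
  (meaningful for open `φ`), built from the selector symbol; `QSym.realize_charTerm`: for open
  `φ`, `charTerm φ = 1 ↔ φ` and `charTerm φ ∈ {0, 1}` in `K` (Krajíček 1995, §5.3: open formulas
  of `PV`-like theories have characteristic terms, by definition by cases);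
* **Skolem terms** (`QSym.exists_skolem_term`): if `K` is moreover Herbrand saturated
  (Avigad 2002, Theorem 3.3) and `K ⊨ ∀ x̄ ∃ y φ(x̄, y)` with `φ` open (parameters from `K` allowed),
  then some term `τ(x̄)` satisfies `K ⊨ ∀ x̄ φ(x̄, τ(x̄))` — Herbrand's theorem in `K`
  (`IsHerbrandSaturated.exists_finset_term`) followed by definition by cases over the finitely
  many candidate terms;
* **Skolem symbols** (`QSym.exists_skolem_sym`): extracting the finitely many parameters of
  `τ` (`QSym.exists_param_term`, by `realize_term_congr_left`) and using that every term is a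
  symbol (`termSym`), the Skolem
  term becomes `x̄ ↦ G(c̄, x̄)` for a symbol `G` and a tuple of parameters `c̄`.

## References

* J. Avigad, *Saturated models of universal theories*, APAL 118 (2002), §3.
* J. Krajíček, *Bounded Arithmetic, Propositional Logic and Complexity Theory*, CUP 1995, §5.3,
  §7.6.
-/

namespace Literature.Computability.MetaComplexity

open FirstOrder FirstOrder.Language FirstOrder.Language.BoundedFormula
open Literature.ModelTheory.UniversalTheories

namespace QSym

open BASICModel

variable {k : ℕ} {K : Type} [Language.boundedArith.Structure K] [(Language.qsym k).Structure K]
  [(qsymι k).IsExpansionOn K]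

/-! ## Characteristic terms of open formulas -/

section CharTerm

variable {α : Type}

/-- The selector applied to four terms. [folklore] -/
def selT (a b c d : (Language.qsym k).Term α) : (Language.qsym k).Term α :=
  Term.func (selV k) ![a, b, c, d]

/-- **The characteristic term of a formula** (by recursion on the formula; quantifiers are sent
to `0`, so this is meaningful for open formulas): `χ(t₁ = t₂) = sel(t₁,t₂,sel(t₂,t₁,1,0),0)`,
`χ(t₁ ≤ t₂) = sel(t₁,t₂,1,0)`, `χ(⊥) = 0`, `χ(φ → ψ) = sel(χ φ, 0, 1, χ ψ)`.
[cite: Krajicek1995, §5.3] -/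
def charTerm : {n : ℕ} → (Language.qsym k).BoundedFormula α n → (Language.qsym k).Term (α ⊕ Fin n)
  | _, falsum => ιt 0
  | _, equal t₁ t₂ => selT t₁ t₂ (selT t₂ t₁ qone (ιt 0)) (ιt 0)
  | _, rel (l := 2) .le ts => selT (ts 0) (ts 1) qone (ιt 0)
  | _, imp φ ψ => selT (charTerm φ) (ιt 0) qone (charTerm ψ)
  | _, all _ => ιt 0

/-- `charTerm` of `⊥`. [folklore] -/
@[simp] theorem charTerm_falsum {n : ℕ} :
    charTerm (falsum : (Language.qsym k).BoundedFormula α n) = ιt 0 := rfl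

/-- `charTerm` of an equation. [folklore] -/
@[simp] theorem charTerm_equal {n : ℕ} (t₁ t₂ : (Language.qsym k).Term (α ⊕ Fin n)) :
    charTerm (equal t₁ t₂) = selT t₁ t₂ (selT t₂ t₁ qone (ιt 0)) (ιt 0) := rfl

/-- `charTerm` of an inequality. [folklore] -/
@[simp] theorem charTerm_rel_le {n : ℕ} (ts : Fin 2 → (Language.qsym k).Term (α ⊕ Fin n)) :
    charTerm (rel (BoundedArithRel.le : (Language.qsym k).Relations 2) ts) =
      selT (ts 0) (ts 1) qone (ιt 0) := rfl

/-- `charTerm` of an inequality (`Relations.boundedFormula` form). [folklore] -/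
@[simp] theorem charTerm_le {n : ℕ} (ts : Fin 2 → (Language.qsym k).Term (α ⊕ Fin n)) :
    charTerm (Relations.boundedFormula (BoundedArithRel.le : (Language.qsym k).Relations 2) ts) =
      selT (ts 0) (ts 1) qone (ιt 0) := rfl

/-- `charTerm` of an implication. [folklore] -/
@[simp] theorem charTerm_imp {n : ℕ} (φ ψ : (Language.qsym k).BoundedFormula α n) :
    charTerm (φ.imp ψ) = selT (charTerm φ) (ιt 0) qone (charTerm ψ) := rfl

variable [hKB : K ⊨ BASIC]

/-- Semantics of `selT` in `K`. [folklore] -/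
theorem realize_selT (hK : K ⊨ univTheory k) (a b c d : (Language.qsym k).Term α) (v : α → K) :
    (selT a b c d).realize v =
      if a.realize v ≤ b.realize v then c.realize v else d.realize v := by
  rw [selT, Term.realize]
  have h := selV_spec hK (k := k)
    ![a.realize v, b.realize v, c.realize v, d.realize v]
  simp only [Matrix.cons_val_zero, Matrix.cons_val_one, Matrix.cons_val] at h
  have e : (fun i => (![a, b, c, d] i).realize v) = ![a.realize v, b.realize v, c.realize v, d.realize v] := by
    funext i; fin_cases i <;> rfl
  rw [e]
  split_ifs with hle
  · exact h.1 hle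
  · exact h.2 (not_le.1 hle)

/-- In `K`, the relation symbol `≤` of `Language.qsym k` means `≤`. [folklore] -/
theorem relMap_qle_iff (w : Fin 2 → K) :
    Structure.RelMap (L := Language.qsym k) BoundedArithRel.le w ↔ w 0 ≤ w 1 := by
  have h := LHom.IsExpansionOn.map_onRelation (ϕ := qsymι k) (M := K) BoundedArithRel.le w
  rw [← mLe_iff]
  have e : w = ![w 0, w 1] := by funext i; fin_cases i <;> rfl
  refine (Iff.of_eq h).trans ?_
  conv_lhs => rw [e]
  rfl

/-- **Correctness of characteristic terms**: for an open formula `φ`, `χ_φ = 1 ↔ φ`, and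
`χ_φ ∈ {0, 1}`. [cite: Krajicek1995, §5.3] -/
theorem realize_charTerm (hK : K ⊨ univTheory k) {n : ℕ} {φ : (Language.qsym k).BoundedFormula α n}
    (hφ : φ.IsQF) (v : α → K) (xs : Fin n → K) :
    ((charTerm φ).realize (Sum.elim v xs) = 1 ↔ φ.Realize v xs) ∧
      ((charTerm φ).realize (Sum.elim v xs) = 0 ∨ (charTerm φ).realize (Sum.elim v xs) = 1) := by
  have h01 : (0 : K) ≠ 1 := zero_ne_one
  have h10 : ¬ ((1 : K) ≤ 0) := not_le.2 zero_lt_one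
  induction hφ with
  | falsum =>
    simp only [charTerm_falsum, realize_ιt, realize_term_zero, mZero_eq]
    exact ⟨⟨fun h => absurd h h01, fun h => h.elim⟩, by simp⟩
  | of_isAtomic h =>
    cases h with
    | equal t₁ t₂ =>
      simp only [Term.bdEqual, charTerm_equal, realize_selT hK, realize_ιt, realize_term_zero,
        realize_natConst_one, mSucc_eq, mZero_eq, zero_add]
      refine ⟨⟨fun h => ?_, fun h => ?_⟩, ?_⟩
      · split_ifs at h with h1 h2
        · exact le_antisymm h1 h2
        · exact absurd h h01
        · exact absurd h h01
      · rw [h, if_pos le_rfl, if_pos le_rfl]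
      · split_ifs <;> simp
    | rel R ts =>
      cases R with
      | le =>
        simp only [charTerm_le, realize_selT hK, realize_ιt,
          realize_term_zero, realize_natConst_one, mSucc_eq, mZero_eq, zero_add,
          BoundedFormula.realize_rel, relMap_qle_iff]
        refine ⟨⟨fun h => ?_, fun h => ?_⟩, ?_⟩
        · split_ifs at h with h1
          · exact h1
          · exact absurd h h01
        · rw [if_pos h]
        · split_ifs <;> simp
  | imp h₁ h₂ ih₁ ih₂ =>
    obtain ⟨i1, c1⟩ := ih₁
    obtain ⟨i2, c2⟩ := ih₂
    simp only [charTerm_imp, realize_selT hK, realize_ιt, realize_term_zero, realize_natConst_one,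
      mSucc_eq, mZero_eq, zero_add, realize_imp]
    rcases c1 with h0 | h1
    · have hφ : ¬ _ := fun h => h01 (h0.symm.trans (i1.2 h))
      rw [h0, if_pos le_rfl]
      exact ⟨⟨fun _ h => absurd h hφ, fun _ => rfl⟩, Or.inr rfl⟩
    · have hφ := i1.1 h1
      rw [h1, if_neg h10]
      exact ⟨⟨fun h _ => i2.1 h, fun h => i2.2 (h hφ)⟩, c2⟩

end CharTerm

/-! ## Skolem terms from Herbrand saturation -/

section Skolem

variable [hKB : K ⊨ BASIC] {kk : ℕ}

/-- The candidate selection: given candidate terms `tt₁, …, tt_N` for the existential variable of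
`φ(x̄, y)`, the term "the first `ttᵢ(x̄)` with `φ(x̄, ttᵢ(x̄))`, else `0`". [folklore] -/
def skolemChain (φ : (Language.qsym k).BoundedFormula (K ⊕ Fin kk) 1) :
    List (Fin 1 → (Language.qsym k).Term (K ⊕ Fin kk)) → (Language.qsym k).Term (K ⊕ Fin kk)
  | [] => ιt 0
  | tt :: rest =>
    selT ((charTerm φ).subst (Sum.elim Term.var fun _ => tt 0)) (ιt 0) (skolemChain φ rest) (tt 0)

/-- Correctness of the candidate selection. [folklore] -/
theorem realize_skolemChain (hK : K ⊨ univTheory k)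
    {φ : (Language.qsym k).BoundedFormula (K ⊕ Fin kk) 1} (hφ : φ.IsQF)
    (L : List (Fin 1 → (Language.qsym k).Term (K ⊕ Fin kk))) (xs : Fin kk → K)
    (h : ∃ tt ∈ L, φ.Realize (Sum.elim id xs) fun j => (tt j).realize (Sum.elim id xs)) :
    φ.Realize (Sum.elim id xs) ![(skolemChain φ L).realize (Sum.elim id xs)] := by
  induction L with
  | nil => simp at h
  | cons tt rest ih =>
    have hc := realize_charTerm hK hφ (Sum.elim id xs) ![(tt 0).realize (Sum.elim id xs)]
    have e1 : (fun j : Fin 1 => (tt j).realize (Sum.elim (id : K → K) xs)) =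
        ![(tt 0).realize (Sum.elim id xs)] := by
      funext j; fin_cases j; rfl
    have ec : ((charTerm φ).subst (Sum.elim Term.var fun _ => tt 0)).realize (Sum.elim id xs) =
        (charTerm φ).realize (Sum.elim (Sum.elim id xs) ![(tt 0).realize (Sum.elim id xs)]) := by
      rw [Term.realize_subst]
      congr 1
      funext a
      rcases a with a | j
      · rfl
      · fin_cases j; rfl
    rw [skolemChain, realize_selT hK, ec]
    simp only [realize_ιt, realize_term_zero, mZero_eq]
    by_cases hφt : φ.Realize (Sum.elim id xs) ![(tt 0).realize (Sum.elim id xs)]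
    · have h1 := hc.1.2 hφt
      rw [h1, if_neg (not_le.2 zero_lt_one)]
      exact hφt
    · have h0 : (charTerm φ).realize (Sum.elim (Sum.elim id xs) ![(tt 0).realize (Sum.elim id xs)]) = 0 :=
        (hc.2.resolve_right fun h1 => hφt (hc.1.1 h1))
      rw [h0, if_pos le_rfl]
      refine ih ?_
      obtain ⟨tt', htt', hφ'⟩ := h
      rcases List.mem_cons.1 htt' with rfl | hmem
      · rw [e1] at hφ'; exact absurd hφ' hφt
      · exact ⟨tt', hmem, hφ'⟩

/-- **Skolem terms in a Herbrand-saturated model of the universal theory.** If `K` is Herbrand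
saturated and `K ⊨ ∀ x̄ ∃ y φ(x̄, y)` with `φ` open (parameters from `K` allowed), then
`K ⊨ ∀ x̄ φ(x̄, τ(x̄))` for some term `τ` (Herbrand's theorem in `K`, Avigad 2002, Theorem 3.3, plus
definition by cases). [cite: Avigad2002, Theorem 3.3] -/
theorem exists_skolem_term (hK : K ⊨ univTheory k)
    (hsat : IsHerbrandSaturated (Language.qsym k) K)
    {φ : (Language.qsym k).BoundedFormula (K ⊕ Fin kk) 1} (hφ : φ.IsQF)
    (h : ∀ xs : Fin kk → K, ∃ y : K, φ.Realize (Sum.elim id xs) ![y]) :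
    ∃ τ : (Language.qsym k).Term (K ⊕ Fin kk),
      ∀ xs : Fin kk → K, φ.Realize (Sum.elim id xs) ![τ.realize (Sum.elim id xs)] := by
  classical
  haveI : Nonempty K := ⟨0⟩
  obtain ⟨s, hs⟩ := hsat.exists_finset_term φ hφ fun xs => by
    obtain ⟨y, hy⟩ := h xs
    exact ⟨![y], hy⟩
  refine ⟨skolemChain φ s.toList, fun xs => realize_skolemChain hK hφ _ xs ?_⟩
  obtain ⟨tt, htt, hφt⟩ := hs xs
  exact ⟨tt, Finset.mem_toList.2 htt, hφt⟩

end Skolem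

/-! ## Extracting parameters: Skolem symbols -/

section Params

variable {α β : Type} {kk : ℕ}

variable [hKB : K ⊨ BASIC]

omit [(qsymι k).IsExpansionOn K] in
/-- **Extracting the parameters of a term**: a term with parameters from `K` is a parameter-free
term applied to a tuple of parameters. [folklore] -/
theorem exists_param_term (τ : (Language.qsym k).Term (K ⊕ Fin kk)) :
    ∃ (q : ℕ) (c : Fin q → K) (τ' : (Language.qsym k).Term (Fin (q + kk))),
      ∀ xs : Fin kk → K, τ.realize (Sum.elim id xs) = τ'.realize (Fin.append c xs) := by
  classical
  let S : Finset K := τ.varFinsetLeft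
  let e := S.equivFin
  let f : K → Fin (S.card + 1) := fun a =>
    if h : a ∈ S then Fin.castSucc (e ⟨a, h⟩) else Fin.last _
  let c : Fin (S.card + 1) → K := Fin.snoc (fun i => (e.symm i).1) 0
  refine ⟨S.card + 1, c, (τ.relabel (Sum.map f id)).relabel finSumFinEquiv, fun xs => ?_⟩
  rw [Term.realize_relabel, Term.realize_relabel]
  have e1 : (Fin.append c xs ∘ ⇑finSumFinEquiv) = Sum.elim c xs := by
    funext x
    rcases x with i | j
    · simp [finSumFinEquiv_apply_left]
    · simp [finSumFinEquiv_apply_right]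
  rw [e1, Sum.elim_comp_map, Function.comp_id]
  refine realize_term_congr_left τ xs fun a ha => ?_
  simp only [Function.comp_apply, f, c]
  rw [dif_pos ha, Fin.snoc_castSucc]
  simp

/-- **Skolem symbols.** In a Herbrand-saturated model of `univTheory k`, if
`K ⊨ ∀ x̄ ∃ y φ(x̄, y)` with `φ` open (parameters allowed) then there are a symbol `G` and
parameters `c̄` with `K ⊨ ∀ x̄ φ(x̄, G(c̄, x̄))`. [cite: Avigad2002, Theorem 3.3] -/
theorem exists_skolem_sym (hK : K ⊨ univTheory k) (hsat : IsHerbrandSaturated (Language.qsym k) K)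
    {φ : (Language.qsym k).BoundedFormula (K ⊕ Fin kk) 1} (hφ : φ.IsQF)
    (h : ∀ xs : Fin kk → K, ∃ y : K, φ.Realize (Sum.elim id xs) ![y]) :
    ∃ (q : ℕ) (c : Fin q → K) (G : QSym k (q + kk)),
      ∀ xs : Fin kk → K, φ.Realize (Sum.elim id xs) ![app G (Fin.append c xs)] := by
  obtain ⟨τ, hτ⟩ := exists_skolem_term hK hsat hφ h
  obtain ⟨q, c, τ', hτ'⟩ := exists_param_term τ
  refine ⟨q, c, termSym τ', fun xs => ?_⟩
  rw [app_termSym hK, ← hτ']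
  exact hτ xs

end Params

end QSym

end Literature.Computability.MetaComplexity
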